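import Summits.QuantumFields.YangMills.Theorems.PencilRigidityWeakCouplingHypercubicLimitDecayTransfer
import HarnessLib

/-!
# Crux `WeakCouplingHypercubicLimit` (stmt-QuantumFields-16120), line `Sketch`, r10: supports, lattice times, box margins and the
# soft identities of the limit on the separated class (toolkit B for `stub_decayOfRPSpectral`)

Sequel of `…DecayTransfer`: `latticeTime_facts` (even lattice times `2⌊t/(2a_k)⌋ a_k → t`), `exists_time_floor`/`exists_radius` (support
floors of compactly supported positive-time tests), `box_margin` (translated lattice supports stay in the torus box), `conj_planeSum_eq`
(the limit is real on real separated tests), `planeSum_translate_eq` (time-translation invariance of the limit for separated tests, from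
the exact torus translation invariance of the mean + the moving limit), `slab_support` (the smeared functional lives in the time slab
`[1, ⌊ρ/a⌋+1]`), and the registered closed form `planeSum_translate_eq'`.

Refs: OsterwalderSeiler1978 §§2–3; OsterwalderSchrader1973 §2, §4.
-/

noncomputable section

open scoped SchwartzMap BigOperators ComplexConjugate
open MeasureTheory Filter Topology
open Literature.MathematicalPhysics.QuantumFieldTheory Literature.MathematicalPhysics.QuantumLattice
open Literature.MathematicalPhysics.AQFT
open Literature.Probability.LatticeModels (box Site)
open Summit.QuantumFields.YangMills.Cruxes.HypercubicLimit.CouplingResponse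
open Summit.QuantumFields.YangMills.Cruxes.OSLegsFromFemtoAndGap.DlrCollarTransfer (plane conn Decay RPPos ConnCS)
open Summit.QuantumFields.YangMills.Cruxes.OSLegsAtWeakCouplingC.Sketch (Separated)
open Summit.QuantumFields.YangMills.Theorems.OSLegsFromFemtoAndGap

namespace Summit.QuantumFields.YangMills.Theorems.WeakCouplingHypercubicLimit.TraceNormColdPressure

variable {G : Type} [Group G] [TopologicalSpace G] [IsTopologicalGroup G] [CompactSpace G]
  [MeasurableSpace G] [BorelSpace G]

/-- **Lattice times**: for `t ≥ 0` and spacings `a_k → 0⁺`, the even lattice times `2⌊t/(2a_k)⌋ a_k` lie in `[t − 2a_k, t]`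
and converge to `t`. [folklore] -/
theorem latticeTime_facts {t : ℝ} (ht : 0 ≤ t) {a : ℕ → ℝ} (ha : ∀ k, 0 < a k) (ha0 : Tendsto a atTop (𝓝 0)) :
    (∀ k, t - 2 * a k ≤ ((2 * ⌊t / (2 * a k)⌋₊ : ℕ) : ℝ) * a k ∧ ((2 * ⌊t / (2 * a k)⌋₊ : ℕ) : ℝ) * a k ≤ t) ∧
      Tendsto (fun k => ((2 * ⌊t / (2 * a k)⌋₊ : ℕ) : ℝ) * a k) atTop (𝓝 t) := by
  have hb : ∀ k, t - 2 * a k ≤ ((2 * ⌊t / (2 * a k)⌋₊ : ℕ) : ℝ) * a k ∧ ((2 * ⌊t / (2 * a k)⌋₊ : ℕ) : ℝ) * a k ≤ t := by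
    intro k
    have hak := ha k
    have h2a : 0 < 2 * a k := by positivity
    have hfl : (⌊t / (2 * a k)⌋₊ : ℝ) ≤ t / (2 * a k) := Nat.floor_le (by positivity)
    have hfl' : t / (2 * a k) < ⌊t / (2 * a k)⌋₊ + 1 := Nat.lt_floor_add_one _
    push_cast
    constructor
    · have := (div_lt_iff₀ h2a).1 hfl'; nlinarith
    · have := (le_div_iff₀ h2a).1 hfl; nlinarith
  refine ⟨hb, ?_⟩
  have hlow : Tendsto (fun k => t - 2 * a k) atTop (𝓝 t) := by simpa using tendsto_const_nhds.sub (ha0.const_mul 2)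
  exact tendsto_of_tendsto_of_tendsto_of_le_of_le hlow tendsto_const_nhds (fun k => (hb k).1) fun k => (hb k).2

/-- `t • e₀ = single 0 t`. [folklore] -/
theorem smul_single_one_eq (t : ℝ) : t • EuclideanSpace.single (0 : Fin 4) (1 : ℝ) = EuclideanSpace.single 0 t := by
  ext i; by_cases hi : i = 0 <;> simp [hi]

/-! ### The decay on the separated class -/

section Decay

variable (r : LatticeRep G) (sch : SpeciesScheme (YMSpecies G)) (φ : ℕ → ℕ) (hφ : StrictMono φ)
  (T : (n : ℕ) → (Fin n → Plane) → (𝓢((Fin n → EuclideanSpace ℝ (Fin 4)), ℂ) →L[ℂ] ℂ))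
  (hUFB : UniformFunctionalBoundPlanes r sch) (hPL : PlaneLimits r sch φ T)
  {n : ℕ} {F : 𝓢((Fin n → EuclideanSpace ℝ (Fin 4)), ℂ)} {ρ τ δ : ℝ} (hτ : 0 < τ) (hδ : 0 < δ) (hρ : 0 ≤ ρ)
  (hFρ : tsupport (F : (Fin n → EuclideanSpace ℝ (Fin 4)) → ℂ) ⊆ Metric.closedBall 0 ρ)
  (hFτ : tsupport (F : (Fin n → EuclideanSpace ℝ (Fin 4)) → ℂ) ⊆ {u | ∀ l, τ ≤ u l 0})
  (hFδ : tsupport (F : (Fin n → EuclideanSpace ℝ (Fin 4)) → ℂ) ⊆ Separated n δ)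
  (hFr : ∀ u, conj (F u) = F u)

include hφ hUFB hPL hτ hδ hρ hFρ hFτ hFδ hFr

omit hφ hUFB hρ hFρ in
/-- The limit family is real on real separated test functions. [folklore] -/
theorem conj_planeSum_eq : conj (planeSum T n F) = planeSum T n F := by
  have h1 := tendsto_mean r sch φ T hPL hτ hδ hFτ hFδ
  have h2 : Tendsto (fun k => ∫ U, fieldObs r (sch.L (φ k)) (sch.a (φ k))
          ((((sch.c r.curvature (φ k) * sch.a (φ k) ^ 4) ^ n : ℝ) : ℂ) • F) (fun _ => sch.m r.curvature (φ k) / 6) U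
        ∂(wilsonMeasure r.ρ (sch.β (φ k)) : Measure (GaugeConfig 4 (2 * sch.L (φ k) + 1) G)))
      atTop (𝓝 (conj (planeSum T n F))) := by
    refine ((Complex.continuous_conj.tendsto _).comp h1).congr' (Eventually.of_forall fun k => ?_)
    simp only [Function.comp_apply]
    rw [← integral_conj]
    refine integral_congr_ae (ae_of_all _ fun U => conj_fieldObs r _ _ _ _ (fun x => ?_) U)
    simp [hFr x]
  exact tendsto_nhds_unique h2 h1

omit hFr hUFB hPL hτ hδ hFτ hFδ in
/-- **Box margins**: eventually, every lattice multi-point at which the smeared test function is non-zero stays in the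
torus box after the lattice time translation by `2⌊t/(2a_k)⌋`. [folklore] -/
theorem box_margin {t : ℝ} (ht : 0 ≤ t) :
    ∀ᶠ k in atTop, ∀ y : Fin n → Site 4,
      ((((sch.c r.curvature (φ k) * sch.a (φ k) ^ 4) ^ n : ℝ) : ℂ) • F) (fun l => sch.a (φ k) • siteToE (y l)) ≠ 0 →
        ∀ l, y l ∈ box 4 (sch.L (φ k)) ∧
          y l + Pi.single 0 ((2 * ⌊t / (2 * sch.a (φ k))⌋₊ : ℕ) : ℤ) ∈ box 4 (sch.L (φ k)) := by
  have haL : Tendsto (fun k => sch.a (φ k) * sch.L (φ k)) atTop atTop := sch.tendsto_L.comp hφ.tendsto_atTop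
  filter_upwards [haL.eventually (eventually_ge_atTop (ρ + t))] with k hk y hy l
  have ha := sch.a_pos (φ k)
  have hy' : F (fun l => sch.a (φ k) • siteToE (y l)) ≠ 0 := by
    intro h; apply hy
    show (_ : ℂ) • F (fun l => sch.a (φ k) • siteToE (y l)) = 0
    rw [h, smul_zero]
  have hmem := thermal_bookkeeping_mem_piFinset_box F ha hFρ hy'
  rw [Fintype.mem_piFinset] at hmem
  have hl := Literature.Probability.LatticeModels.mem_box.1 (hmem l)
  have hN : ((⌊ρ / sch.a (φ k)⌋₊ : ℕ) : ℝ) + (2 * ⌊t / (2 * sch.a (φ k))⌋₊ : ℕ) ≤ sch.L (φ k) := by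
    have h1 : ((⌊ρ / sch.a (φ k)⌋₊ : ℕ) : ℝ) ≤ ρ / sch.a (φ k) := Nat.floor_le (by positivity)
    have h2 : ((2 * ⌊t / (2 * sch.a (φ k))⌋₊ : ℕ) : ℝ) ≤ t / sch.a (φ k) := by
      have hfl : (⌊t / (2 * sch.a (φ k))⌋₊ : ℝ) ≤ t / (2 * sch.a (φ k)) := Nat.floor_le (by positivity)
      push_cast
      rw [le_div_iff₀ ha]
      have := (le_div_iff₀ (by positivity : (0:ℝ) < 2 * sch.a (φ k))).1 hfl
      nlinarith
    have h3 : ρ / sch.a (φ k) + t / sch.a (φ k) ≤ sch.L (φ k) := by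
      rw [← add_div, div_le_iff₀ ha]; nlinarith
    linarith
  have hN' : (⌊ρ / sch.a (φ k)⌋₊ : ℤ) + (2 * ⌊t / (2 * sch.a (φ k))⌋₊ : ℕ) ≤ sch.L (φ k) := by exact_mod_cast hN
  refine ⟨Literature.Probability.LatticeModels.mem_box.2 fun i => ⟨by linarith [(hl i).1], by linarith [(hl i).2]⟩,
    Literature.Probability.LatticeModels.mem_box.2 fun i => ?_⟩
  by_cases hi : i = 0
  · subst hi
    simp only [Pi.add_apply, Pi.single_eq_same]
    constructor <;> push_cast at hN' ⊢ <;> linarith [(hl 0).1, (hl 0).2]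
  · simp only [Pi.add_apply, Pi.single_eq_of_ne hi, add_zero]
    exact ⟨by linarith [(hl i).1], by linarith [(hl i).2]⟩

omit hFr in
/-- Translates of the limit's argument: `planeSum T n (T_{t e₀} F) = planeSum T n F` for the lattice-approximable
translation `t = lim 2 j_k a_k` — exact torus translation invariance of the mean at each step + the moving limit. [folklore] -/
theorem planeSum_translate_eq {t : ℝ} (ht : 0 ≤ t) :
    planeSum T n (translateMulti (EuclideanSpace.single (0 : Fin 4) t) F) = planeSum T n F := by
  classical
  -- the lattice translation vectors
  set jj : ℕ → ℕ := fun k => ⌊t / (2 * sch.a (φ k))⌋₊ with hjj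
  set vv : ℕ → EuclideanSpace ℝ (Fin 4) := fun k =>
    ((((2 * jj k : ℕ) : ℝ) * sch.a (φ k)) • EuclideanSpace.single (0 : Fin 4) (1 : ℝ)) with hvv
  have ha0 : Tendsto (fun k => sch.a (φ k)) atTop (𝓝 0) := sch.tendsto_a.comp hφ.tendsto_atTop
  have hcoef : Tendsto (fun k => ((2 * jj k : ℕ) : ℝ) * sch.a (φ k)) atTop (𝓝 t) :=
    (latticeTime_facts ht (fun k => sch.a_pos (φ k)) ha0).2
  have hvv_lim : Tendsto vv atTop (𝓝 (EuclideanSpace.single (0 : Fin 4) t)) := by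
    have h := hcoef.smul_const (EuclideanSpace.single (0 : Fin 4) (1 : ℝ))
    rwa [smul_single_one_eq] at h
  -- the means of the translated functionals converge to the translated limit …
  have hFo : IsOffDiagonal F := isOffDiagonal_of_posSep (posSep_of_separated hδ hτ hFδ hFτ)
  have hlim1 : Tendsto (fun k => ∑ q : Fin n → Plane, planeDist r sch (φ k) n q (translateMulti (vv k) F)) atTop
      (𝓝 (planeSum T n (translateMulti (EuclideanSpace.single (0 : Fin 4) t) F))) := by
    have h : Tendsto (fun k => ∑ q : Fin n → Plane, planeDist r sch (φ k) n q (translateMulti (vv k) F)) atTop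
        (𝓝 (∑ q : Fin n → Plane, T n q (translateMulti (EuclideanSpace.single (0 : Fin 4) t) F))) :=
      tendsto_finsetSum _ fun q _ => planeDist_tendsto_of_tendsto G r sch φ T hUFB hPL n q (fun k => translateMulti (vv k) F)
        _ (fun k => hFo.translateMulti _) (hFo.translateMulti _) (((continuous_translateMulti F).tendsto _).comp hvv_lim)
    unfold planeSum; rwa [FunLike.coe_sum, Finset.sum_apply]
  -- … and are eventually equal to the means of the untranslated ones (torus translation invariance)
  have hbox := box_margin r sch φ hφ hρ hFρ ht
  have hlim2 : Tendsto (fun k => ∑ q : Fin n → Plane, planeDist r sch (φ k) n q (translateMulti (vv k) F)) atTop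
      (𝓝 (planeSum T n F)) := by
    refine (tendsto_mean r sch φ T hPL hτ hδ hFτ hFδ).congr' ?_
    filter_upwards [hbox] with k hk
    rw [← (fieldObs_expectation_facts G r).1 sch (φ k) n (translateMulti (vv k) F)]
    have hsm : ((((sch.c r.curvature (φ k) * sch.a (φ k) ^ 4) ^ n : ℝ) : ℂ) • translateMulti (vv k) F) =
        translateMulti (vv k) ((((sch.c r.curvature (φ k) * sch.a (φ k) ^ 4) ^ n : ℝ) : ℂ) • F) := by
      rw [map_smul]
    rw [hsm, hvv]
    exact ((fieldObs_expectation_facts G r).2.2.2 (sch.L (φ k)) (sch.β (φ k)) (sch.a (φ k)) n (2 * jj k) _ _ hk).symm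
  exact tendsto_nhds_unique hlim1 hlim2

end Decay


/-! ### The lattice decay inequality and its limit -/

section Main

variable (r : LatticeRep G) (sch : SpeciesScheme (YMSpecies G)) (φ : ℕ → ℕ) (hφ : StrictMono φ)
  (T : (n : ℕ) → (Fin n → Plane) → (𝓢((Fin n → EuclideanSpace ℝ (Fin 4)), ℂ) →L[ℂ] ℂ))
  (hUFB : UniformFunctionalBoundPlanes r sch) (hPL : PlaneLimits r sch φ T)
  {n : ℕ} {F : 𝓢((Fin n → EuclideanSpace ℝ (Fin 4)), ℂ)} {ρ τ δ : ℝ} (hτ : 0 < τ) (hδ : 0 < δ) (hρ : 0 ≤ ρ)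
  (hFρ : tsupport (F : (Fin n → EuclideanSpace ℝ (Fin 4)) → ℂ) ⊆ Metric.closedBall 0 ρ)
  (hFτ : tsupport (F : (Fin n → EuclideanSpace ℝ (Fin 4)) → ℂ) ⊆ {u | ∀ l, τ ≤ u l 0})
  (hFδ : tsupport (F : (Fin n → EuclideanSpace ℝ (Fin 4)) → ℂ) ⊆ Separated n δ)
  (hFr : ∀ u, conj (F u) = F u)

include hφ hUFB hPL hτ hδ hρ hFρ hFτ hFδ hFr

omit hφ hUFB hPL hδ hρ hFδ hFr in
/-- **Slab support**: the smeared renormalised functional only sees lattice multi-points in the time slab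
`[1, ⌊ρ/a⌋ + 1]`. [folklore] -/
theorem slab_support (k : ℕ) :
    ∀ y : Fin n → Site 4,
      ((((sch.c r.curvature (φ k) * sch.a (φ k) ^ 4) ^ n : ℝ) : ℂ) • F) (fun l => sch.a (φ k) • siteToE (y l)) ≠ 0 →
        ∀ l, 1 ≤ y l 0 ∧ y l 0 + 1 ≤ ((⌊ρ / sch.a (φ k)⌋₊ + 2 : ℕ) : ℤ) := by
  intro y hy l
  have ha := sch.a_pos (φ k)
  have hy' : F (fun l => sch.a (φ k) • siteToE (y l)) ≠ 0 := by
    intro h; apply hy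
    show (_ : ℂ) • F (fun l => sch.a (φ k) • siteToE (y l)) = 0
    rw [h, smul_zero]
  have hmem : (fun l => sch.a (φ k) • siteToE (y l)) ∈ tsupport (F : (Fin n → EuclideanSpace ℝ (Fin 4)) → ℂ) :=
    subset_tsupport _ (Function.mem_support.2 hy')
  have hbox := thermal_bookkeeping_mem_piFinset_box F ha hFρ hy'
  rw [Fintype.mem_piFinset] at hbox
  have hl := (Literature.Probability.LatticeModels.mem_box.1 (hbox l)) 0
  constructor
  · -- `τ ≤ a y⁰` with `a, τ > 0` forces `y⁰ ≥ 1`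
    have h1 : τ ≤ sch.a (φ k) * (y l 0 : ℝ) := by
      have := hFτ hmem l
      simpa [siteToE_apply] using this
    have h2 : (0 : ℝ) < (y l 0 : ℝ) := by
      by_contra hneg; push Not at hneg
      nlinarith
    have h3 : (0 : ℤ) < y l 0 := by exact_mod_cast h2
    omega
  · push_cast; linarith [hl.2]

end Main

/-- **Registered sub-goal `planeSum_translate_eq'` (line `Sketch`, r10 decay toolkit B)**: closed form of `planeSum_translate_eq`. [folklore] -/
theorem planeSum_translate_eq' :
    ∀ (G : Type) [Group G] [TopologicalSpace G] [IsTopologicalGroup G] [CompactSpace G]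
      [MeasurableSpace G] [BorelSpace G] (r : LatticeRep G) (sch : SpeciesScheme (YMSpecies G)) (φ : ℕ → ℕ) (hφ : StrictMono φ)
      (T : (n : ℕ) → (Fin n → Plane) → (𝓢((Fin n → EuclideanSpace ℝ (Fin 4)), ℂ) →L[ℂ] ℂ)),
      UniformFunctionalBoundPlanes r sch → PlaneLimits r sch φ T →
      ∀ (n : ℕ) (F : 𝓢((Fin n → EuclideanSpace ℝ (Fin 4)), ℂ)) (ρ τ δ : ℝ), 0 < τ → 0 < δ → 0 ≤ ρ →
      tsupport (F : (Fin n → EuclideanSpace ℝ (Fin 4)) → ℂ) ⊆ Metric.closedBall 0 ρ →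
      tsupport (F : (Fin n → EuclideanSpace ℝ (Fin 4)) → ℂ) ⊆ {u | ∀ l, τ ≤ u l 0} →
      tsupport (F : (Fin n → EuclideanSpace ℝ (Fin 4)) → ℂ) ⊆ Separated n δ →
      ∀ t : ℝ, 0 ≤ t → planeSum T n (translateMulti (EuclideanSpace.single (0 : Fin 4) t) F) = planeSum T n F :=
  fun _ _ _ _ _ _ _ r sch φ hφ T hUFB hPL _ _ _ _ _ hτ hδ hρ hFρ hFτ hFδ _ ht =>
    planeSum_translate_eq r sch φ hφ T hUFB hPL hτ hδ hρ hFρ hFτ hFδ ht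

end Summit.QuantumFields.YangMills.Theorems.WeakCouplingHypercubicLimit.TraceNormColdPressure

end
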